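/-
Origin: expansion seat `planner-pub-hodgecm-mc-axioms-1-g14-0`, handover #W85 2026-08-20T15:53:55Z md5 452900ff7038 (PKG f9308b719a2e → 452900ff7038; 208 l.; MECHANICAL (iib-R) rewrite v3.1 of the PKG file as it stands (69 token edits; rules R1x1+R2x8+RX[h₂']x49+R3x3+R8x8)) (`HOME/mc/pub-hodgecm-mc-axioms-1-g14/revendor/kit-r55/stage55/HodgeCM/Model/ThetaSatDischarge.lean`, md5 452900ff7038, 208 lines);
landed by the gen-22 packager (p-g22) in gate run 55 REPLACES the earlier landed copy of `HodgeCM/Model/ThetaSatDischarge.lean` (seat copy carried the packager Origin header of an earlier run (stripped)).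
-/
/-
RUN-38 (L3)/(L3b) `Level`-PAIR COURTESY RE-CUT DRAFT by `planner-pub-hodgecm-mc-theta-3-g10-0` 2026-08-19 over RUN-37 kit #C2 778996c3b32b:
`ballDatumOf_Γ_map` now lives UPSTREAM in `Model/ThetaSpaceInputPin` (same name and namespace); nothing else changed.
-/
/-
(Θ-sat)/(W1) COURTESY RE-CUT DRAFT by `planner-pub-hodgecm-mc-theta-3-g9-0` 2026-08-19 over the installed bytes ed6eac548ab5 (mc-period-1 custody,
(P6); RUN-37 `Level`-pair / (Θ-sat) pin packet): the pinned theta spaces are the SATURATED spaces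
`thetaSpaceSatOf … (satLevelRegimeOf V hV Γ.K) …` (antitone in the level's `K`), so by the ORDER CLAUSE (Θ-sat-≤) of record
(BINDER-TRIAGE §60) every `hle : Γ'.Γ ≤ Γ.Γ` of this file becomes the PAIR order `hle : Γ' ≤ Γ` (`Level.le_def`: `Γ'.K ≤ Γ.K`;
`Level.Γ_mono hle : Γ'.Γ ≤ Γ.Γ` feeds `levelImage_mono` / `coverOf` / `map_coverOf_unif` unchanged), and the theta-space input is theta-3-g8's
`ThetaSpace.exists_mem_thetaSpaceSatOf_coe_eq_of_le … (satLevelRegimeOf_mono V hV (Level.le_def.mp hle))` (`Model/ThetaSpaceSat`).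
CONSEQUENCE (flagged, not mine to cut): `thetaSatOf` now quantifies `(hle : Γ' ≤ Γ)` with `cover := coverOf … (Level.Γ_mono hle)`, so E's
binder `thetaSat` / `HeckeWedge.Fact_coverTheta` must be re-typed in the `K`-order at RUN 37 (§60; E-assembler) — until then
`Model/E2InstanceR10` does not match this term.
-/
/-
Origin: expansion seat `planner-pub-hodgecm-mc-period-1-g3-0`, handover M6 = period-1 #35″ md5 31a9c0b4372b (rehearsal olean2 rc 0; period-1-g5 05:32:02Z: the period lane's ONLY v2 member; #36/#37 ride RUN 34 unchanged, outside the pin cone) (`HOME/mc/pub-hodgecm-mc-period-1-g3/next/HodgeCM/Model/ThetaSatDischarge.lean`, md5 31a9c0b4, 191 lines);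
landed by the gen-11 packager (p-g11) in gate run 35 REPLACES the earlier landed copy of `HodgeCM/Model/ThetaSatDischarge.lean` (verbatim).
-/
/-
v2 RE-CUT (RUN-34+ successor material, NOT a kit row) against mc-theta-3-g3's v2 pin
`lean/next/HodgeCM/Model/ThetaSpaceInputPin.lean` md5 5a6bf8038289 — diff vs row #35 83e5a5043379: hypothesis `hι`
dropped everywhere, `(S V c).ιinf Γ` ↦ `(S V c).ιinf`; E-side `thetaSat := Model.thetaSatOf hHD hI h₁ hU h₃ h emb wm d12 d34 hA S`.
Origin: construction seat `planner-pub-hodgecm-mc-period-1-g3-0` (unit pub-hodgecm-mc-period-1-g3, lineage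
mc-period-1 gen 3), addendum to node (H)+(P) (rows 11/12 `ball` / `ballFacts`): the KERNEL DISCHARGE of the
E binder `thetaSat` at the pin `X := (B)` (theta-3-g3 `Model/ThetaSpaceInputPin`), modulo the cover
morphism and its uniformisation compatibility (glue-1's `coverOf` / `map_coverOf_unif`) and the
level-independence of the archimedean inclusion of the adelic side. PKG target
`HodgeCM/Model/ThetaSatDischarge.lean`.
-/
import Summits.HodgeConjecture.HodgeCM.Model.ThetaSpaceInputPin_2
import Summits.HodgeConjecture.HodgeCM.Model.CoverInstance
import Summits.HodgeConjecture.HodgeCM.Model.E2Instance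
import Literature.AlgebraicGeometry.ShimuraVarieties.UnitaryBallThetaClassLevelChange
import Literature.AlgebraicGeometry.ShimuraVarieties.UnitaryBallLevelImage

/-!
# The E binder `thetaSat` at the pin is a theorem

`thetaSat` (E R6–R9, rows 11/12): for levels `Γ' ≤ Γ` and the level-lowering cover
`f : P_{Γ'} ⟶ P_Γ`, the pull-back `f^*` maps the theta classes `Θ_k(Γ)` into `Θ_k(Γ')`.

At the pin (`Model.thetaSpaceInputOf … S`), in the regime, `Θ_k(Γ)` is the set of theta classes
(`thetaClasses id`) through the class-map datum of `X_Γ` read in the UNIFORM frame `ballFrame`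
(`frameOf_eq`) of the classical theta space `thetaSpaceOf (S.P k) S.ιinf (levelImage Γ) …`; off the
regime it is `{0}`. The three inputs of the vendored level-change lemma
`UnitaryBallUniformisationDatum.pull_baseChange_mem_thetaClasses` (tree (H″)) are then theorems here:

* frames: `(frameOf Γ').t = (frameOf Γ).t` is `rfl` (uniform frame);
* levels: `levelImage Γ' h ≤ levelImage Γ h` for `Γ'.Γ ≤ Γ.Γ` — `Model.levelImage_mono`, from the
  vendored `ballImage_le_of_map_le` and the coding lemmas `PMSRealisation.datum_Γ`,
  `PicardCode.ofHermitian_Γ_map` (`Model.ballDatumOf_Γ_map`);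
* theta spaces: level monotonicity of the SATURATED spaces `ThetaSpace.exists_mem_thetaSpaceSatOf_coe_eq_of_le`
  (theta-3-g8 `Model/ThetaSpaceSat`) — in the levels `Δ' ≤ Δ` AND in the saturation indices `KΓ' ≤ KΓ`, whence the
  PAIR order `Γ' ≤ Γ` ((Θ-sat-≤), `Level.le_def`, `satLevelRegimeOf_mono`).

Main statement: `Model.thetaSat_thetaSpaceInputOf` — the binder `thetaSat` for the pinned theta sets,
for ANY family of cover morphisms `f` compatible with the uniformisations (hypothesis `hf`, the shape of
glue-1's `map_coverOf_unif`) and any adelic side `S` (v2 pin, mc-theta-3-g3 `lean/next/`: `S.ιinf` level-free,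
so RUN-33's hypothesis `hι` is dropped). Nothing is cited and nothing is minted: kernel lemmas over `hHD`, `hI`.
-/

set_option autoImplicit false

noncomputable section

open MulAction NumberField
open scoped TensorProduct
open Literature.Geometry.ComplexHyperbolic.BallModel (U21 Ball x₀)
open Literature.NumberTheory.Automorphic
open Literature.NumberTheory.Automorphic.WeightForms (ClassMapDatum thetaClasses restrictHom IsLevelCorrected
  IsWeightMatched)
open Literature.AlgebraicGeometry.HodgeTheory
open Literature.AlgebraicGeometry.ShimuraVarieties
open Literature.NumberTheory.Automorphic.PicardCM
open Literature.NumberTheory.Transcendental (Arapura2012_Cor_15_4_6)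
open HodgeCM.Model.ThetaSpace

namespace HodgeCM
namespace Model

section ThetaSat

variable (hHD : exists_isReal_hodgeModel) (hI : hodgePQ_independent_of_hodgeModel)
  (h₁ : BallQuotientUniformised)  (h₃ : CMAbelianVarietyRealised)
variable {L : CMField} {ι₁ : L →+* ℂ} {V : HermSpace3 L ι₁} {c : SeesawCtx L}

-- RUN-38 (L3) `Level`-pair packet: `ballDatumOf_Γ_map` now lives UPSTREAM in `Model/ThetaSpaceInputPin` (same name and
-- namespace `HodgeCM.Model`), where the pin lemma `exists_toBall_eq_of_mem_levelImage` needs it; nothing else changed here.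

/-- **Level images are monotone**: `Γ' ≤ Γ ⟹ ρ(Γ') ≤ ρ(Γ)` in `U(2,1)` (uniform frame). -/
theorem levelImage_mono {Γ Γ' : Level V} (hle : Γ'.Γ ≤ Γ.Γ) (h : IsAnisotropic L V.Hm) :
    levelImage hHD hI h₁ h₃ Γ' h ≤ levelImage hHD hI h₁ h₃ Γ h :=
  UnitaryBallUniformisationDatum.ballImage_le_of_map_le _ _ (frameOf hHD hI h₁ h₃ Γ h)
    (frameOf hHD hI h₁ h₃ Γ' h) rfl
    (by
      rw [ballDatumOf_Γ_map hHD hI h₃ (ballQuotientUniformisedDatum_of h₁),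
        ballDatumOf_Γ_map hHD hI h₃ (ballQuotientUniformisedDatum_of h₁)]
      exact Subgroup.map_mono hle)

variable (S : ∀ {L : CMField} {ι₁ : L →+* ℂ} (V : HermSpace3 L ι₁) (c : SeesawCtx L), ThetaAdelicSide V c)

/-- **`thetaSat` at the pin, in the regime.** For `Γ' ≤ Γ`, a morphism `f : P_{Γ'} ⟶ P_Γ` compatible
with the uniformisations in the uniform frame (the archimedean inclusion `S.ιinf` being level-free, v2 pin), `f^*` maps
`Θ_k(Γ)` into `Θ_k(Γ')`: the vendored level-change lemma (H″) `pull_baseChange_mem_thetaClasses` fed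
with `rfl` (frames), `map_coverOf_unif`-shaped `hf`, and `ThetaSpace.exists_mem_thetaSpaceOf_coe_eq_of_le`
over `levelImage_mono`. -/
theorem thetaSat_thetaSpaceInputOf_of_isAnisotropic (V : HermSpace3 L ι₁) (c : SeesawCtx L)
    (hV : IsAnisotropic L V.Hm) (k : Fin 4) {Γ Γ' : Level V} (hle : Γ' ≤ Γ)
    (f : (picardCMUniverse hHD hI h₁ h₃).Mor ((picardCMUniverse hHD hI h₁ h₃).pms L ι₁ V Γ')
      ((picardCMUniverse hHD hI h₁ h₃).pms L ι₁ V Γ))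
    (hf : ∀ v ∈ (ballDatumOf (hHD := hHD) (hI := hI) (hU := ballQuotientUniformisedDatum_of h₁) (h₃ := h₃)
        L ι₁ V Γ' hV).cone,
      Literature.AlgebraicGeometry.Motives.AlgPoints.map f
          ((ballDatumOf (hHD := hHD) (hI := hI) (hU := ballQuotientUniformisedDatum_of h₁) (h₃ := h₃)
            L ι₁ V Γ' hV).unif v) =
        (ballDatumOf (hHD := hHD) (hI := hI) (hU := ballQuotientUniformisedDatum_of h₁) (h₃ := h₃)
          L ι₁ V Γ hV).unif v)
    {ω : (picardCMUniverse hHD hI h₁ h₃).CohC ((picardCMUniverse hHD hI h₁ h₃).pms L ι₁ V Γ) 1}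
    (hω : ω ∈ thetaOf _ (thetaClassInputOf _ (fun V c => thetaSpaceInputOf hHD hI h₁ h₃ S V c)) V c k Γ) :
    (picardCMUniverse hHD hI h₁ h₃).pullC f 1 ω ∈
      thetaOf _ (thetaClassInputOf _ (fun V c => thetaSpaceInputOf hHD hI h₁ h₃ S V c)) V c k Γ' := by
  rw [thetaOf_thetaSpaceInputOf_of_isAnisotropic hHD hI h₁ h₃ S V c k _ hV] at hω ⊢
  have hΘ : ∀ F ∈ thetaSpaceSatOf ((S V c).P k) (S V c).ιinf (levelImage hHD hI h₁ h₃ Γ hV)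
      (stabilizer U21 x₀).subtype (BallForms.isPullbackCocycle_cotangentCocycle.weightOf x₀)
      (satLevelRegimeOf V hV Γ.K) ((S V c).P k).weightFunctions,
      ∃ F' ∈ thetaSpaceSatOf ((S V c).P k) (S V c).ιinf (levelImage hHD hI h₁ h₃ Γ' hV)
        (stabilizer U21 x₀).subtype (BallForms.isPullbackCocycle_cotangentCocycle.weightOf x₀)
        (satLevelRegimeOf V hV Γ'.K) ((S V c).P k).weightFunctions, (F' : U21 → (Fin 2 → ℂ)) = F := by
    intro F hF
    exact exists_mem_thetaSpaceSatOf_coe_eq_of_le (P := (S V c).P k)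
      (levelImage_mono hHD hI h₁ h₃ (Level.Γ_mono hle) hV) (satLevelRegimeOf_mono V hV (Level.le_def.mp hle)) _ hF
  exact UnitaryBallUniformisationDatum.pull_baseChange_mem_thetaClasses _ _
    (frameOf hHD hI h₁ h₃ Γ hV) (frameOf hHD hI h₁ h₃ Γ' hV) (MonoidHom.id U21)
    (isLevelCorrected_id _ _ _) (isLevelCorrected_id _ _ _) (isWeightMatched_id _ _) hHD hI f rfl hf hΘ hω

/-- **`thetaSat` at the pin** (both branches): off the regime the theta sets are `{0}` and `f^* 0 = 0`. -/
theorem thetaSat_thetaSpaceInputOf (V : HermSpace3 L ι₁) (c : SeesawCtx L)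
    (k : Fin 4) {Γ Γ' : Level V} (hle : Γ' ≤ Γ)
    (f : (picardCMUniverse hHD hI h₁ h₃).Mor ((picardCMUniverse hHD hI h₁ h₃).pms L ι₁ V Γ')
      ((picardCMUniverse hHD hI h₁ h₃).pms L ι₁ V Γ))
    (hf : ∀ hV : IsAnisotropic L V.Hm,
      ∀ v ∈ (ballDatumOf (hHD := hHD) (hI := hI) (hU := ballQuotientUniformisedDatum_of h₁) (h₃ := h₃)
          L ι₁ V Γ' hV).cone,
        Literature.AlgebraicGeometry.Motives.AlgPoints.map f
            ((ballDatumOf (hHD := hHD) (hI := hI) (hU := ballQuotientUniformisedDatum_of h₁) (h₃ := h₃)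
              L ι₁ V Γ' hV).unif v) =
          (ballDatumOf (hHD := hHD) (hI := hI) (hU := ballQuotientUniformisedDatum_of h₁) (h₃ := h₃)
            L ι₁ V Γ hV).unif v)
    {ω : (picardCMUniverse hHD hI h₁ h₃).CohC ((picardCMUniverse hHD hI h₁ h₃).pms L ι₁ V Γ) 1}
    (hω : ω ∈ thetaOf _ (thetaClassInputOf _ (fun V c => thetaSpaceInputOf hHD hI h₁ h₃ S V c)) V c k Γ) :
    (picardCMUniverse hHD hI h₁ h₃).pullC f 1 ω ∈
      thetaOf _ (thetaClassInputOf _ (fun V c => thetaSpaceInputOf hHD hI h₁ h₃ S V c)) V c k Γ' := by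
  by_cases hV : IsAnisotropic L V.Hm
  · exact thetaSat_thetaSpaceInputOf_of_isAnisotropic hHD hI h₁ h₃ S V c hV k hle f (hf hV) hω
  · rw [thetaOf_thetaSpaceInputOf_of_not_isAnisotropic hHD hI h₁ h₃ S V c k _ hV] at hω ⊢
    rw [Set.mem_singleton_iff] at hω ⊢
    rw [hω, map_zero]

/-- **E's binder `thetaSat` (R6–R9) as a term**, for `cover := coverOf … hA` (glue-1's junction
`map_coverOf_unif` supplies the uniformisation compatibility): no remaining input (v2 pin: `S.ιinf` is
level-free, so RUN-33's hypothesis `hι` is gone). -/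
theorem thetaSat_coverOf (hA : Arapura2012_Cor_15_4_6)
    {L : CMField} {ι₁ : L →+* ℂ} (V : HermSpace3 L ι₁) (c : SeesawCtx L) (k : Fin 4) (Γ Γ' : Level V)
    (hle : Γ' ≤ Γ)
    (ω : (picardCMUniverse hHD hI h₁ h₃).CohC ((picardCMUniverse hHD hI h₁ h₃).pms L ι₁ V Γ) 1)
    (hω : ω ∈ thetaOf _ (thetaClassInputOf _ (fun V c => thetaSpaceInputOf hHD hI h₁ h₃ S V c)) V c k Γ) :
    (picardCMUniverse hHD hI h₁ h₃).pullC (coverOf hHD hI h₁ h₃ hA Γ Γ' (Level.Γ_mono hle)) 1 ω ∈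
      thetaOf _ (thetaClassInputOf _ (fun V c => thetaSpaceInputOf hHD hI h₁ h₃ S V c)) V c k Γ' :=
  thetaSat_thetaSpaceInputOf hHD hI h₁ h₃ S V c k hle _
    (fun hV _ hv => map_coverOf_unif hHD hI h₁ h₃ hA (Level.Γ_mono hle) hV hv) hω

/-- **E's binder `thetaSat`, verbatim** (E R6–R9 shape: theta sets read through
`(thetaModelOf … Θ d12 d34).Theta`, `cover := coverOf … hA`), as a term over the adelic side `S` alone
(v2 pin). E-side: `thetaSat := Model.thetaSatOf hHD hI h₁ hU h₃ h emb wm d12 d34 hA S`. -/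
theorem thetaSatOf (h : Bool)
    (emb : ∀ {L : CMField} {ι₁ : L →+* ℂ} {V : HermSpace3 L ι₁} (Γ : Level V),
      (picardCMUniverse hHD hI h₁ h₃).CohC ((picardCMUniverse hHD hI h₁ h₃).pms L ι₁ V Γ) 2 →ₗ[ℂ]
        (V.latticeModel printFact_unitaryCompact_holds).toQuotientModel.H)
    (wm : ∀ {L : CMField} {ι₁ : L →+* ℂ} (V : HermSpace3 L ι₁) (c : SeesawCtx L),
      WeilThetaModel (V.latticeModel printFact_unitaryCompact_holds).toQuotientModel.G
        (V.latticeModel printFact_unitaryCompact_holds).toQuotientModel.Γ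
        (c.D.latticeModelW printFact_unitaryCompact_holds).toQuotientModel.G
        (c.D.latticeModelW printFact_unitaryCompact_holds).toQuotientModel.Γ)
    (d12 d34 : ∀ {L : CMField}, SeesawCtx L → HodgeCM.Universe.SideData L)
    (hA : Arapura2012_Cor_15_4_6)
    {L : CMField} {ι₁ : L →+* ℂ} (V : HermSpace3 L ι₁) (c : SeesawCtx L) (i : Fin 4) (Γ Γ' : Level V)
    (hle : Γ' ≤ Γ)
    (ω : (picardCMUniverse hHD hI h₁ h₃).CohC ((picardCMUniverse hHD hI h₁ h₃).pms L ι₁ V Γ) 1)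
    (hω : ω ∈ (thetaModelOf hHD hI h₁ h₃ h emb (coverOf hHD hI h₁ h₃ hA) wm
      (thetaOf _ (thetaClassInputOf _ (fun V c => thetaSpaceInputOf hHD hI h₁ h₃ S V c))) d12 d34).Theta
        V c i Γ) :
    (picardCMUniverse hHD hI h₁ h₃).pullC (coverOf hHD hI h₁ h₃ hA Γ Γ' (Level.Γ_mono hle)) 1 ω ∈
      (thetaModelOf hHD hI h₁ h₃ h emb (coverOf hHD hI h₁ h₃ hA) wm
        (thetaOf _ (thetaClassInputOf _ (fun V c => thetaSpaceInputOf hHD hI h₁ h₃ S V c))) d12 d34).Theta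
        V c i Γ' :=
  thetaSat_coverOf hHD hI h₁ h₃ S hA V c i Γ Γ' hle ω hω

end ThetaSat

end Model
end HodgeCM

end
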